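import Summits.Ventures.HodgeRepro2.T5CubeTypes

/-!
# T5DatumAssembly — Lemma N.2 of route/T5-N2-route-3.md as ONE kernel statement on the CM field

`lemma_N2_complete` assembles, for a CM frame `τ₁, τ₂, τ₃` of the CM field `K` and admissible
`e₁₁₁, e₁₀₀` (p1's `IsLiuSignElement` for the cube vertices `111`, `100` of `T5CubeTypes`), a
totally real `u ≠ 0` with — in the order of N2.1(b) and rows N2.2.6 / N2.2.8 / N2.2.9 /
N2.2.11 / N2.2.12:

1. `u e₁₁₁` admissible for `101` and `u⁻¹ e₁₀₀` admissible for `110` (row N2.2.8);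
2. `(u e₁₁₁)(u⁻¹ e₁₀₀) = e₁₁₁ e₁₀₀` exactly — the determinant classes of row N2.2.9 coincide
   before any passage to classes;
3. `Re φ(u) < 0` exactly for `φ ∈ {τ₂, τ̄₂}` — the sign vector `(+, −, +)` and row N2.2.12's
   «`ν(g) = u⁻¹ < 0` exactly at `ι₂`»;
4. the similitude identity of row N2.2.11 on `K × K`: with `pairForm` of `T5DatumSimilitude`
   (`⟨(x, y), (x', y')⟩ = x x̄' e + y ȳ' e'`) and `g₀(x, y) = (u⁻¹ x, y)`,
   `⟨g₀ v, g₀ w⟩_{101,110} = u⁻¹ ⟨v, w⟩_{111,100}`;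
5. all four forms are skew-hermitian (the generators are trace-zero);
6. both pairs have the signatures `(0,2), (1,1), (1,1)` at the three real places
   (row N2.2.6).

Everything is a corollary of `T5CubeTypes.lemma_N2_datum` / `signature_datum` and the model
identities of `T5DatumSimilitude`, instantiated at the CM field itself.  No Literature fact is
asserted.
-/

namespace Summit.Ventures.HodgeRepro2.T5DatumAssembly

open NumberField NumberField.ComplexEmbedding
open Summit.Ventures.HodgeRepro2.T5DatumSimilitude
open Summit.Ventures.HodgeRepro2.T5CubeTypes

variable {K : Type*} [Field K] [NumberField K] [IsCMField K]

/-- **Lemma N.2, assembled.** -/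
theorem lemma_N2_complete {τ : Fin 3 → (K →+* ℂ)} (hτ : IsCMFrame τ) {e₁ e₂ : K}
    (he₁ : IsLiuSignElement K (cubeType τ t111) e₁)
    (he₂ : IsLiuSignElement K (cubeType τ t100) e₂) :
    ∃ u : K, star u = u ∧ u ≠ 0 ∧
      -- (1) admissibility of the new representatives
      IsLiuSignElement K (cubeType τ t101) (u * e₁) ∧
      IsLiuSignElement K (cubeType τ t110) (u⁻¹ * e₂) ∧
      -- (2) the exact product identity
      (u * e₁) * (u⁻¹ * e₂) = e₁ * e₂ ∧
      -- (3) the sign vector (+, −, +)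
      (∀ φ : K →+* ℂ, (φ u).re < 0 ↔ (φ = τ 1 ∨ φ = conjugate (τ 1))) ∧
      -- (4) the similitude of multiplier u⁻¹
      (∀ v w : K × K, pairForm (u * e₁) (u⁻¹ * e₂) (g0 u v) (g0 u w) =
        u⁻¹ * pairForm e₁ e₂ v w) ∧
      -- (5) skew-hermitian forms
      (∀ v w : K × K, star (pairForm e₁ e₂ v w) = - pairForm e₁ e₂ w v) ∧
      (∀ v w : K × K, star (pairForm (u * e₁) (u⁻¹ * e₂) v w) =
        - pairForm (u * e₁) (u⁻¹ * e₂) w v) ∧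
      -- (6) equal signatures at the three real places
      signature (signVecOf τ e₁) (signVecOf τ e₂) = ![(0, 2), (1, 1), (1, 1)] ∧
      signature (signVecOf τ (u * e₁)) (signVecOf τ (u⁻¹ * e₂)) = ![(0, 2), (1, 1), (1, 1)] := by
  obtain ⟨u, hu, hu0, h101, h110, hprod, hsign⟩ := lemma_N2_datum hτ he₁ he₂
  obtain ⟨hsigA, hsigB⟩ := signature_datum hτ he₁ he₂ h101 h110
  refine ⟨u, hu, hu0, h101, h110, hprod, hsign, fun v w => pairForm_g0 hu hu0 e₁ e₂ v w,
    fun v w => star_pairForm he₁.1 he₂.1 v w, fun v w => star_pairForm h101.1 h110.1 v w,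
    hsigA, hsigB⟩

omit [NumberField K] [IsCMField K] in
/-- The two pairs of the datum have literally the same Gram determinant after any scaling by a
trace-zero `δ` (row N2.2.9): `(δ⁻¹ u e₁)(δ⁻¹ u⁻¹ e₂) = (δ⁻¹ e₁)(δ⁻¹ e₂)`. -/
theorem det_scaled_datum {u : K} (hu0 : u ≠ 0) (δ e₁ e₂ : K) :
    (Matrix.diagonal ![δ⁻¹ * (u * e₁), δ⁻¹ * (u⁻¹ * e₂)]).det =
      (Matrix.diagonal ![δ⁻¹ * e₁, δ⁻¹ * e₂]).det :=
  det_scaled_eq hu0 δ e₁ e₂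

end Summit.Ventures.HodgeRepro2.T5DatumAssembly
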